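import Mathlib
import HarnessLib
import Summits.Langlands.Langlands.Theses.SkinnerWilesDefectOne
import Literature.NumberTheory.GaloisRepresentations.NearlyOrdinaryDeformationRing
import Literature.NumberTheory.GaloisRepresentations.FrobeniusGeneration
import Literature.NumberTheory.GaloisRepresentations.IntegralGaloisActionProofs
import Summits.Langlands.Langlands.Theorems.SkinnerWilesDefectOneReducibleOrdinaryProModularDefs

/-! # The level-raising divisor lies in the Steinberg locus: helper file `…LevelRaisingDivisorAux` for
stub `stub_iharaCrossingLocal` of line steinberg-hyperplane (crux ReducibleOrdinaryProModular, stmt-Langlands-12919)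

Route `SkinnerWilesDefectOne`, infrastructure for the lead's crossing stub S5' (`stub_iharaCrossingLocal`), which
runs through the LEVEL-RAISING DIVISOR `V(f_{v₀}) ⊆ Spec R_𝒟`, `f_{v₀} = q·tr(ρ_𝒟(Frob_{v₀}))² − (1+q)²·det(ρ_𝒟(Frob_{v₀}))`,
`q = N v₀` (`= −(qα − β)(α − qβ)` on Frobenius eigenvalues): its points are the primes `𝔮` modulo which the
Frobenius eigenvalue ratio is `q^{±1}`.  Proved here, kernel-checked: such a prime, when `ρ_𝒟 mod 𝔮` is UNRAMIFIED
at `v₀`, lies in `steinbergLocus 𝓡 v₀` (`IsSteinbergShapedAt`: at every `𝔓 ∣ v₀` a frame with the decomposition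
group upper triangular, inertia unipotent, and `(sub entry) = q · (quotient entry)` on arithmetic Frobenii — the
"level-raising degeneration" of the Steinberg shape).

* §1 two-by-two algebra: the `(1,0)`/`(0,0)` entries of `P⁻¹ M P` via the first column of `P`, powers stay upper
  triangular, completion of a vector to a frame, and **(A) `exists_frame_of_levelRaising`**: `Φ ∈ GL₂(K)` with
  `q·tr(Φ)² = (1+q)²·det Φ`, `1 + q ≠ 0` in `K`, is conjugate in `GL₂(K)` to an upper-triangular matrix with
  `a = q·d` (the characteristic polynomial has the roots `qt/(1+q)`, `t/(1+q)` IN `K`).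
* §2 the adic step: over `K = Frac(A)` the frame condition `(P⁻¹ M P)₁₀ = 0` is, after clearing the denominators
  of the first column `(x, y)` of `P`, the vanishing of the `A`-linear form `ℓ(M) = x(M₁₀x + M₁₁y) − y(M₀₀x + M₀₁y)`
  (`conj_apply_one_zero_eq_zero_iff_of_col`); and `form_eq_zero_of_frobenius_generation`: `ℓ(ρ(φⁿ)) = 0` for all
  `n` and `σ = φⁿ·i·u` with `ρ(i) = 1`, `ρ(u) ≡ 1 (mod J^m)` for every `m` give `ℓ(ρ σ) ∈ ⋂ₘ J^m = 0` (Krull).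
* §3 **(B)** `conj_apply_one_zero_eq_zero_of_mem_decompositionSubgroup`: for `ρ_𝒟 mod 𝔮` unramified at `w`, a
  frame of ONE arithmetic Frobenius at `𝔓 ∣ w` over `Frac(R/𝔮)` frames the whole decomposition group
  (`G_𝔓 = ⟨φ⟩·I_𝔓·U` for the open kernels `U = ker(ρ_𝒟 mod 𝔪_R^m)`, `exists_eq_frobenius_pow_mul_of_mem_decompositionSubgroup`
  + `IsLift.isAdicContinuous`, and Krull's intersection theorem in the Noetherian domain `R/𝔮`);
  `isSteinbergShapedAt_of_prime` (one prime above `w` suffices: `Γ_F` is transitive on `w.primesAbove`);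
  `mem_steinbergLocus_of_levelRaising` and its `R`-level form `…_of_mem` (`f_w(φ) ∈ 𝔮`, `1 + q ∉ 𝔮`).
* §4 the REGISTERED wrapper `stub_iharaCrossingLocal_auxLevelRaisingDivisor` (sub-goal of stmt-Langlands-12919).

References: SkinnerWiles1999 §2.1, §4.1; K. Ribet, *Congruence relations between modular forms*, Proc. ICM 1983,
Thm. 1 (the level-raising condition `a_v² = (1 + N v)²`); R. Taylor, Publ. Math. IHÉS 108 (2008) §3 (the
`(1,1)`/Steinberg components); Neukirch, *Algebraic Number Theory* I §9.  Everything below is elementary and proved.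
-/


set_option linter.dupNamespace false
set_option autoImplicit false

namespace Summit.Langlands.Langlands.Cruxes.ReducibleOrdinaryProModular.SteinbergHyperplane

open scoped NumberField MatrixGroups Pointwise
open Filter NumberField IsDedekindDomain Field Polynomial Matrix
open Literature.NumberTheory.Automorphic Literature.NumberTheory.Automorphic.BigHeckeGLn
open Literature.NumberTheory.GaloisRepresentations
open Summit.Langlands.Langlands.Theses.SkinnerWilesDefectOne

noncomputable section

/-! ## 1. Two-by-two algebra -/

section TwoByTwo

variable {K : Type*} [CommRing K]

/-- **Entries in a frame.**  For `P, M ∈ GL₂` with `v = (x, y)` the first column of `P` (from `P·(P⁻¹MP) = MP`):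
`det P · (P⁻¹ M P)₁₀ = x (Mv)₁ − y (Mv)₀` — so `(P⁻¹ M P)₁₀ = 0` says `v` is an eigenvector of `M` — and
`det P · (P⁻¹ M P)₀₀ = P₁₁ (Mv)₀ − P₀₁ (Mv)₁` (`= λ · det P` if `Mv = λv`). [folklore] -/
theorem det_mul_conj_apply (P M : GL (Fin 2) K) :
    P.val.det * (P⁻¹ * M * P).val 1 0 =
      P.val 0 0 * (M.val 1 0 * P.val 0 0 + M.val 1 1 * P.val 1 0) -
        P.val 1 0 * (M.val 0 0 * P.val 0 0 + M.val 0 1 * P.val 1 0) ∧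
    P.val.det * (P⁻¹ * M * P).val 0 0 =
      P.val 1 1 * (M.val 0 0 * P.val 0 0 + M.val 0 1 * P.val 1 0) -
        P.val 0 1 * (M.val 1 0 * P.val 0 0 + M.val 1 1 * P.val 1 0) := by
  set X := P⁻¹ * M * P with hX
  have h : P * X = M * P := by rw [hX]; group
  have h0 := congrFun (congrFun (congrArg (fun Y : GL (Fin 2) K => Y.val) h) 0) 0
  have h1 := congrFun (congrFun (congrArg (fun Y : GL (Fin 2) K => Y.val) h) 1) 0
  simp only [Units.val_mul, Matrix.mul_apply, Fin.sum_univ_two] at h0 h1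
  rw [Matrix.det_fin_two]
  exact ⟨by linear_combination P.val 0 0 * h1 - P.val 1 0 * h0,
    by linear_combination P.val 1 1 * h0 - P.val 0 1 * h1⟩

/-- Powers of a matrix upper triangular in the frame `P` are upper triangular in the frame `P`. [folklore] -/
theorem conj_pow_apply_one_zero (P Φ : GL (Fin 2) K) (h : (P⁻¹ * Φ * P).val 1 0 = 0) (n : ℕ) :
    (P⁻¹ * Φ ^ n * P).val 1 0 = 0 := by
  induction n with
  | zero => simp
  | succ n ih =>
    have e : P⁻¹ * Φ ^ (n + 1) * P = (P⁻¹ * Φ ^ n * P) * (P⁻¹ * Φ * P) := by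
      rw [pow_succ]; group
    rw [e, Units.val_mul, Matrix.mul_apply, Fin.sum_univ_two, ih, h, zero_mul, mul_zero, add_zero]

/-- Every non-zero vector of `K²` (`K` a field) is the first column of an invertible matrix. [folklore] -/
theorem exists_frame_col_eq {K : Type*} [Field K] (v : Fin 2 → K) (hv : v ≠ 0) :
    ∃ P : GL (Fin 2) K, P.val 0 0 = v 0 ∧ P.val 1 0 = v 1 := by
  by_cases h0 : v 0 = 0
  · have h1 : v 1 ≠ 0 := fun h1 => hv (funext fun i => by fin_cases i <;> assumption)
    refine ⟨Matrix.GeneralLinearGroup.mkOfDetNeZero !![v 0, 1; v 1, 0] ?_, rfl, rfl⟩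
    rw [Matrix.det_fin_two_of, h0]
    simpa using h1
  · refine ⟨Matrix.GeneralLinearGroup.mkOfDetNeZero !![v 0, 0; v 1, 1] ?_, rfl, rfl⟩
    rw [Matrix.det_fin_two_of]
    simpa using h0

/-- **(A) The level-raising frame.**  Let `K` be a field, `q ∈ ℕ` with `1 + q ≠ 0` in `K`, and `Φ ∈ GL₂(K)`
with `q · tr(Φ)² = (1 + q)² · det Φ` (Ribet's level-raising identity: `(qα − β)(α − qβ) = 0` on eigenvalues).  Then
`Φ` is conjugate IN `GL₂(K)` to an upper-triangular matrix with diagonal `(a, d)`, `a = q · d`: for `t = tr Φ`,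
`μ = t/(1+q)` one has `qμ + μ = t`, `qμ·μ = det Φ`, so `qμ ∈ K` is a root of the characteristic polynomial; an
eigenvector for `qμ` (`Matrix.exists_mulVec_eq_zero_iff`) completed to a frame `P` gives `(P⁻¹ΦP)₁₀ = 0`,
`(P⁻¹ΦP)₀₀ = qμ`, `(P⁻¹ΦP)₁₁ = t − qμ = μ`.  (For `q = 1` in `K`, `Φ` may be a Jordan block: still fine.) [folklore] -/
theorem exists_frame_of_levelRaising {K : Type*} [Field K] (q : ℕ) (hq : (1 + q : K) ≠ 0)
    (Φ : GL (Fin 2) K)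
    (hlr : (q : K) * (Matrix.trace Φ.val) ^ 2 = (1 + q) ^ 2 * Matrix.det Φ.val) :
    ∃ P : GL (Fin 2) K, (P⁻¹ * Φ * P).val 1 0 = 0 ∧
      (P⁻¹ * Φ * P).val 0 0 = (q : K) * (P⁻¹ * Φ * P).val 1 1 := by
  classical
  set t : K := Matrix.trace Φ.val with ht
  set μ : K := t * (1 + (q : K))⁻¹ with hμ
  have htr : (q : K) * μ + μ = t := by rw [hμ]; field_simp; ring
  have hdet : (q : K) * μ * μ = Matrix.det Φ.val := by rw [hμ]; field_simp; linear_combination hlr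
  have e2 : Φ.val 0 0 + Φ.val 1 1 = (q : K) * μ + μ := by rw [htr, ht, Matrix.trace_fin_two]
  have e1 : Φ.val 0 0 * Φ.val 1 1 - Φ.val 0 1 * Φ.val 1 0 = (q : K) * μ * μ := by
    rw [hdet, Matrix.det_fin_two]
  -- `qμ` is an eigenvalue: `det (Φ − qμ) = 0`
  have hsing : (Φ.val - ((q : K) * μ) • (1 : Matrix (Fin 2) (Fin 2) K)).det = 0 := by
    rw [Matrix.det_fin_two]
    simp only [Matrix.sub_apply, Matrix.smul_apply, Matrix.one_apply_eq, Matrix.one_apply_ne (by decide : (0 : Fin 2) ≠ 1),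
      Matrix.one_apply_ne (by decide : (1 : Fin 2) ≠ 0), smul_eq_mul, mul_one, mul_zero, sub_zero]
    linear_combination e1 - ((q : K) * μ) * e2
  obtain ⟨v, hv0, hv⟩ := Matrix.exists_mulVec_eq_zero_iff.mpr hsing
  have hv' : ∀ i : Fin 2, Φ.val i 0 * v 0 + Φ.val i 1 * v 1 = (q : K) * μ * v i := by
    intro i
    have h := congrFun hv i
    rw [Matrix.sub_mulVec, Pi.sub_apply, Pi.zero_apply, Matrix.smul_mulVec, Matrix.one_mulVec,
      Pi.smul_apply, smul_eq_mul, sub_eq_zero] at h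
    have h2 : (Φ.val *ᵥ v) i = Φ.val i 0 * v 0 + Φ.val i 1 * v 1 := by
      simp [Matrix.mulVec, dotProduct, Fin.sum_univ_two]
    rw [← h2, h]
  obtain ⟨P, hP0, hP1⟩ := exists_frame_col_eq v hv0
  have hPdet : P.val.det ≠ 0 := ((Matrix.isUnit_iff_isUnit_det _).mp P.isUnit).ne_zero
  -- the entries of `P⁻¹ Φ P`
  obtain ⟨h, h'⟩ := det_mul_conj_apply P Φ
  rw [hP0, hP1] at h h'
  have h10 : (P⁻¹ * Φ * P).val 1 0 = 0 := by
    refine (mul_eq_zero.mp ?_).resolve_left hPdet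
    rw [h]; linear_combination (v 0) * hv' 1 - (v 1) * hv' 0
  have h00 : (P⁻¹ * Φ * P).val 0 0 = (q : K) * μ := by
    refine sub_eq_zero.mp ((mul_eq_zero.mp ?_).resolve_left hPdet)
    rw [mul_sub, h', Matrix.det_fin_two, hP0, hP1]
    linear_combination (P.val 1 1) * hv' 0 - (P.val 0 1) * hv' 1
  have h11 : (P⁻¹ * Φ * P).val 1 1 = μ := by
    have htrc : (P⁻¹ * Φ * P).val 0 0 + (P⁻¹ * Φ * P).val 1 1 = Φ.val 0 0 + Φ.val 1 1 := by
      rw [← Matrix.trace_fin_two, ← Matrix.trace_fin_two, Units.val_mul, Units.val_mul]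
      exact Matrix.trace_units_conj' P Φ.val
    rw [h00, e2] at htrc
    linear_combination htrc
  exact ⟨P, h10, by rw [h00, h11]⟩

end TwoByTwo

/-! ## 2. The adic step: frames over `Frac(A)` versus linear forms over `A`, and Krull -/

section Adic

/-- **Clearing denominators in a frame.**  `A` a domain with fraction field `K`, `P ∈ GL₂(K)`, `b ≠ 0`, `x`,
`y ∈ A` with `(x, y) = b · (first column of P)` in `K`.  For `M ∈ GL₂(A)`: `(P⁻¹ M P)₁₀ = 0 ↔ x(M₁₀x + M₁₁y) −
y(M₀₀x + M₀₁y) = 0` in `A` (`b² · det P · (P⁻¹ M P)₁₀` is the image of the right-hand side). [folklore] -/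
theorem conj_apply_one_zero_eq_zero_iff_of_col {A : Type*} [CommRing A] [IsDomain A] {K : Type*} [Field K]
    [Algebra A K] [IsFractionRing A K] (P : GL (Fin 2) K) {b x y : A} (hb : b ≠ 0)
    (hx : algebraMap A K x = algebraMap A K b * P.val 0 0)
    (hy : algebraMap A K y = algebraMap A K b * P.val 1 0) (M : GL (Fin 2) A) :
    (P⁻¹ * Matrix.GeneralLinearGroup.map (algebraMap A K) M * P).val 1 0 = 0 ↔
      x * (M.val 1 0 * x + M.val 1 1 * y) - y * (M.val 0 0 * x + M.val 0 1 * y) = 0 := by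
  have hdet : P.val.det ≠ 0 := ((Matrix.isUnit_iff_isUnit_det _).mp P.isUnit).ne_zero
  have hbK : algebraMap A K b ≠ 0 := (map_ne_zero_iff _ (IsFractionRing.injective A K)).mpr hb
  have h := (det_mul_conj_apply P (Matrix.GeneralLinearGroup.map (algebraMap A K) M)).1
  have key : algebraMap A K (x * (M.val 1 0 * x + M.val 1 1 * y) - y * (M.val 0 0 * x + M.val 0 1 * y)) =
      algebraMap A K b ^ 2 *
        (P.val.det * (P⁻¹ * Matrix.GeneralLinearGroup.map (algebraMap A K) M * P).val 1 0) := by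
    rw [h]
    simp only [map_sub, map_mul, map_add, hx, hy, Matrix.GeneralLinearGroup.map_apply]
    ring
  refine ⟨fun h0 => IsFractionRing.injective A K ?_, fun h0 => ?_⟩
  · rw [key, h0, mul_zero, mul_zero, map_zero]
  · rw [h0, map_zero, zero_eq_mul, mul_eq_zero] at key
    rcases key with h2 | h2 | h2
    · exact absurd (pow_eq_zero_iff two_ne_zero |>.mp h2) hbK
    · exact absurd h2 hdet
    · exact h2

/-- **Krull step.**  `ρ : Γ → GL₂(A)`, `J` an ideal with `⋂ₘ J^m = 0`, `ℓ(M) = x(M₁₀x + M₁₁y) − y(M₀₀x + M₀₁y)`.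
If `ℓ(ρ(φⁿ)) = 0` for all `n` and for every `m`, `σ = φⁿ·i·u` with `ρ(i) = 1`, `ρ(u) = 1 + E`, `E ≡ 0 (mod J^m)`,
then `ℓ(ρ σ) = 0` (`ρ σ = ρ(φⁿ) + ρ(φⁿ)E`, `ℓ` additive, `ℓ(ρ(φⁿ)E) ∈ J^m`). [folklore] -/
theorem form_eq_zero_of_frobenius_generation {Γ : Type*} [Group Γ] {A : Type*} [CommRing A]
    (ρ : Γ →* GL (Fin 2) A) (J : Ideal A) (hJ : ⨅ m : ℕ, J ^ m = ⊥) (x y : A) (φ σ : Γ)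
    (hφ : ∀ n : ℕ, x * ((ρ (φ ^ n)).val 1 0 * x + (ρ (φ ^ n)).val 1 1 * y) -
      y * ((ρ (φ ^ n)).val 0 0 * x + (ρ (φ ^ n)).val 0 1 * y) = 0)
    (hσ : ∀ m : ℕ, ∃ (n : ℕ) (i u : Γ) (E : Matrix (Fin 2) (Fin 2) A),
      ρ i = 1 ∧ (∀ a c, E a c ∈ J ^ m) ∧ (ρ u).val = 1 + E ∧ σ = φ ^ n * i * u) :
    x * ((ρ σ).val 1 0 * x + (ρ σ).val 1 1 * y) - y * ((ρ σ).val 0 0 * x + (ρ σ).val 0 1 * y) = 0 := by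
  rw [← Ideal.mem_bot, ← hJ, Ideal.mem_iInf]
  intro m
  obtain ⟨n, i, u, E, hi, hE, hu, rfl⟩ := hσ m
  set N : Matrix (Fin 2) (Fin 2) A := (ρ (φ ^ n)).val with hN
  have hval : (ρ (φ ^ n * i * u)).val = N + N * E := by
    rw [map_mul, map_mul, hi, mul_one, Units.val_mul, hu, mul_add, mul_one]
  have hNE : ∀ a c, (N * E) a c ∈ J ^ m := fun a c => by
    rw [Matrix.mul_apply, Fin.sum_univ_two]
    exact add_mem (Ideal.mul_mem_left _ _ (hE 0 c)) (Ideal.mul_mem_left _ _ (hE 1 c))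
  have hsplit : x * ((N + N * E) 1 0 * x + (N + N * E) 1 1 * y) - y * ((N + N * E) 0 0 * x + (N + N * E) 0 1 * y) =
      (x * (N 1 0 * x + N 1 1 * y) - y * (N 0 0 * x + N 0 1 * y)) +
        (x * ((N * E) 1 0 * x + (N * E) 1 1 * y) - y * ((N * E) 0 0 * x + (N * E) 0 1 * y)) := by
    simp only [Matrix.add_apply]; ring
  rw [hval, hsplit, hφ n, zero_add]
  exact sub_mem
    (Ideal.mul_mem_left _ _ (add_mem (Ideal.mul_mem_right _ _ (hNE 1 0)) (Ideal.mul_mem_right _ _ (hNE 1 1))))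
    (Ideal.mul_mem_left _ _ (add_mem (Ideal.mul_mem_right _ _ (hNE 0 0)) (Ideal.mul_mem_right _ _ (hNE 0 1))))

end Adic

/-! ## 3. (B) The Galois part -/

section Galois

variable {F : Type} [Field F] [NumberField F] {p : ℕ}

/-- **One prime above `w` suffices for `IsSteinbergShapedAt`.**  If at SOME `𝔓 ∣ w` a frame `P` makes the
decomposition group upper triangular, inertia unipotent and arithmetic Frobenii satisfy `a = N w · d`, then `ρ` is
Steinberg-shaped at `w`: any other prime is `g • 𝔓` (`Γ_F` transitive on `w.primesAbove`), `D`, `I`, `Frob` conjugate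
by `g`, and the frame `ρ(g) P` works there (`(ρ(g)P)⁻¹ ρ(σ) (ρ(g)P) = P⁻¹ ρ(g⁻¹σg) P`). [folklore] -/
theorem isSteinbergShapedAt_of_prime {A : Type*} [CommRing A] {w : HeightOneSpectrum (𝓞 F)}
    (ρA : absoluteGaloisGroup F →* GL (Fin 2) A) {𝔓 : Ideal (absIntegers (𝓞 F) F)}
    (h𝔓 : 𝔓 ∈ w.primesAbove) (P : GL (Fin 2) A)
    (hup : ∀ σ ∈ 𝔓.decompositionSubgroup (absoluteGaloisGroup F), (P⁻¹ * ρA σ * P).val 1 0 = 0)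
    (hin : ∀ σ ∈ 𝔓.inertia (absoluteGaloisGroup F),
      (P⁻¹ * ρA σ * P).val 0 0 = 1 ∧ (P⁻¹ * ρA σ * P).val 1 1 = 1)
    (hfr : ∀ σ : absoluteGaloisGroup F, IsArithFrobAt (𝓞 F) σ 𝔓 →
      (P⁻¹ * ρA σ * P).val 0 0 = (Ideal.absNorm w.asIdeal : A) * (P⁻¹ * ρA σ * P).val 1 1) :
    IsSteinbergShapedAt w ρA := by
  intro 𝔓' h𝔓'
  obtain ⟨g, rfl⟩ := HeightOneSpectrum.exists_smul_eq_of_mem_primesAbove_holds h𝔓 h𝔓'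
  have hconj : ∀ σ, (ρA g * P)⁻¹ * ρA σ * (ρA g * P) = P⁻¹ * ρA (g⁻¹ * σ * g) * P := fun σ => by
    rw [map_mul, map_mul, map_inv]; group
  refine ⟨ρA g * P, fun σ hσ => ?_, fun σ hσ => ?_, fun σ hσ => ?_⟩
  · rw [hconj]
    refine hup _ ?_
    rwa [Ideal.decompositionSubgroup_smul, Subgroup.mem_pointwise_smul_iff_inv_smul_mem, MulAut.smul_def,
      MulAut.conj_inv_apply] at hσ
  · rw [hconj]
    refine hin _ ?_
    intro x
    have hx : σ • g • x - g • x ∈ g • 𝔓 := hσ (g • x)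
    rw [Ideal.mem_pointwise_smul_iff_inv_smul_mem, smul_sub] at hx
    simpa [mul_smul] using hx
  · rw [hconj]
    refine hfr _ ?_
    rw [HeightOneSpectrum.isArithFrobAt_iff_of_mem_primesAbove h𝔓'] at hσ
    rw [HeightOneSpectrum.isArithFrobAt_iff_of_mem_primesAbove h𝔓]
    intro x
    have hx := hσ (g • x)
    rw [Ideal.mem_pointwise_smul_iff_inv_smul_mem, smul_sub, smul_pow'] at hx
    simpa [mul_smul] using hx

variable {𝒪 : Type} [CommRing 𝒪] {k : Type} [Field k] [Algebra 𝒪 k] {𝒟 : NearlyOrdinaryDatum F p 𝒪 k}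

/-- **(B, core) In the unramified case a frame of ONE Frobenius frames the decomposition group.**  Let
`ρ_𝒟 mod 𝔮` be unramified at `w`, `𝔓 ∣ w`, `φ` an arithmetic Frobenius at `𝔓`, `P ∈ GL₂(Frac(R/𝔮))` with
`(P⁻¹ ρ_𝔮(φ) P)₁₀ = 0`.  Then `(P⁻¹ ρ_𝔮(σ) P)₁₀ = 0` for all `σ ∈ G_𝔓`: clear the denominators of the first column
of `P` to get the form `ℓ` of §2; `ℓ(ρ(φⁿ)) = 0`; for each `m`, `σ = φⁿ i u` with `i ∈ I_𝔓` (`ρ_𝔮(i) = 1`) and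
`u ∈ ker(ρ_𝒟 mod 𝔪_R^m)` (open, `IsLift.isAdicContinuous`; `exists_eq_frobenius_pow_mul_of_mem_decompositionSubgroup`),
so `ρ_𝔮(u) = 1 + E`, `E ≡ 0 mod (𝔪_R·R/𝔮)^m`; conclude by Krull `⋂ₘ (𝔪_R·R/𝔮)^m = 0` in the Noetherian domain `R/𝔮`.
[folklore] -/
theorem conj_apply_one_zero_eq_zero_of_mem_decompositionSubgroup (𝓡 : NearlyOrdinaryDeformationRing.{0} 𝒟)
    {w : HeightOneSpectrum (𝓞 F)} (𝔮 : PrimeSpectrum 𝓡.R)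
    (hunr : Deformation.IsUnramifiedAt w (𝓡.modPrime 𝔮))
    {𝔓 : Ideal (absIntegers (𝓞 F) F)} (h𝔓 : 𝔓 ∈ w.primesAbove)
    {φ : absoluteGaloisGroup F} (hφ : IsArithFrobAt (𝓞 F) φ 𝔓)
    (P : GL (Fin 2) (FractionRing (𝓡.R ⧸ 𝔮.asIdeal)))
    (hP : (P⁻¹ * fracModPrime 𝓡 𝔮 φ * P).val 1 0 = 0)
    {σ : absoluteGaloisGroup F} (hσ : σ ∈ 𝔓.decompositionSubgroup (absoluteGaloisGroup F)) :
    (P⁻¹ * fracModPrime 𝓡 𝔮 σ * P).val 1 0 = 0 := by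
  classical
  -- clear the denominators of the first column of `P`
  obtain ⟨b, hbint⟩ := IsLocalization.exist_integer_multiples_of_finite (nonZeroDivisors (𝓡.R ⧸ 𝔮.asIdeal))
    (fun i : Fin 2 => P.val i 0)
  obtain ⟨x, hx⟩ := hbint 0
  obtain ⟨y, hy⟩ := hbint 1
  simp only [Algebra.smul_def] at hx hy
  have hb : (b : 𝓡.R ⧸ 𝔮.asIdeal) ≠ 0 := nonZeroDivisors.coe_ne_zero b
  have htrans := fun M => conj_apply_one_zero_eq_zero_iff_of_col P hb hx hy M
  -- `fracModPrime = GL₂(algebraMap) ∘ modPrime`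
  change (P⁻¹ * Matrix.GeneralLinearGroup.map (algebraMap (𝓡.R ⧸ 𝔮.asIdeal) (FractionRing (𝓡.R ⧸ 𝔮.asIdeal)))
    (𝓡.modPrime 𝔮 σ) * P).val 1 0 = 0
  rw [htrans]
  -- the ideal `J = 𝔪_R · (R/𝔮)` and Krull
  set J : Ideal (𝓡.R ⧸ 𝔮.asIdeal) := (IsLocalRing.maximalIdeal 𝓡.R).map (Ideal.Quotient.mk 𝔮.asIdeal) with hJdef
  have hJ : ⨅ m : ℕ, J ^ m = ⊥ := by
    haveI : J.IsPrime := Ideal.map_isPrime_of_surjective Ideal.Quotient.mk_surjective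
      (by rw [Ideal.mk_ker]; exact IsLocalRing.le_maximalIdeal (Ideal.IsPrime.ne_top inferInstance))
    exact Ideal.iInf_pow_eq_bot_of_isDomain J (Ideal.IsPrime.ne_top inferInstance)
  refine form_eq_zero_of_frobenius_generation (𝓡.modPrime 𝔮) J hJ x y φ σ (fun n => ?_) (fun m => ?_)
  · refine (htrans _).mp ?_
    rw [map_pow, map_pow]
    exact conj_pow_apply_one_zero P _ hP n
  · obtain ⟨n, i, u, hi, hu, h⟩ :=
      exists_eq_frobenius_pow_mul_of_mem_decompositionSubgroup h𝔓 hφ (𝓡.isLift.isAdicContinuous m) hσ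
    refine ⟨n, i, u, ((𝓡.ρ u).val - 1).map (Ideal.Quotient.mk 𝔮.asIdeal), hunr 𝔓 h𝔓 i hi, fun a c => ?_, ?_, h⟩
    · -- entries of `ρ(u) − 1` lie in `𝔪_R^m`
      have h1 : ((𝓡.ρ u).val - 1).map (Ideal.Quotient.mk (IsLocalRing.maximalIdeal 𝓡.R ^ m)) = 0 := by
        have h2 := congrArg Units.val (MonoidHom.mem_ker.mp hu)
        rw [Units.val_one] at h2
        change (Ideal.Quotient.mk _).mapMatrix (𝓡.ρ u).val = 1 at h2
        rw [← RingHom.mapMatrix_apply, map_sub, h2, map_one, sub_self]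
      have h3 := congrFun (congrFun h1 a) c
      rw [Matrix.map_apply, Matrix.zero_apply, Ideal.Quotient.eq_zero_iff_mem] at h3
      rw [hJdef, ← Ideal.map_pow, Matrix.map_apply]
      exact Ideal.mem_map_of_mem _ h3
    · change (Ideal.Quotient.mk 𝔮.asIdeal).mapMatrix (𝓡.ρ u).val = _
      rw [← RingHom.mapMatrix_apply, ← map_one (Ideal.Quotient.mk 𝔮.asIdeal).mapMatrix, ← map_add,
        add_sub_cancel]

/-- **(B) The level-raising divisor lies in the Steinberg locus (unramified case).**  Let `ρ_𝒟 mod 𝔮` be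
unramified at `w`, `q = N w` with `1 + q ≠ 0` in `K = Frac(R/𝔮)`, and suppose some arithmetic Frobenius `φ` at some
`𝔓 ∣ w` satisfies `q · tr(ρ_𝔮(φ))² = (1 + q)² · det(ρ_𝔮(φ))` over `K`.  Then `𝔮 ∈ steinbergLocus 𝓡 w`: the frame
of (A) for `ρ_𝔮(φ)` triangularises `G_𝔓` (core lemma), inertia maps to `1`, every arithmetic Frobenius `φ'` at `𝔓`
has `ρ_𝔮(φ') = ρ_𝔮(φ)` (`φ'φ⁻¹ ∈ I_𝔓`), and one prime suffices (`isSteinbergShapedAt_of_prime`). [folklore] -/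
theorem mem_steinbergLocus_of_levelRaising (𝓡 : NearlyOrdinaryDeformationRing.{0} 𝒟)
    (w : HeightOneSpectrum (𝓞 F)) (𝔮 : PrimeSpectrum 𝓡.R)
    (hunr : Deformation.IsUnramifiedAt w (𝓡.modPrime 𝔮))
    (hq : (1 + (Ideal.absNorm w.asIdeal : FractionRing (𝓡.R ⧸ 𝔮.asIdeal))) ≠ 0)
    {𝔓 : Ideal (absIntegers (𝓞 F) F)} (h𝔓 : 𝔓 ∈ w.primesAbove)
    {φ : absoluteGaloisGroup F} (hφ : IsArithFrobAt (𝓞 F) φ 𝔓)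
    (hlr : (Ideal.absNorm w.asIdeal : FractionRing (𝓡.R ⧸ 𝔮.asIdeal)) *
        Matrix.trace (fracModPrime 𝓡 𝔮 φ).val ^ 2 =
      (1 + (Ideal.absNorm w.asIdeal : FractionRing (𝓡.R ⧸ 𝔮.asIdeal))) ^ 2 *
        Matrix.det (fracModPrime 𝓡 𝔮 φ).val) :
    𝔮 ∈ steinbergLocus 𝓡 w := by
  obtain ⟨P, hP10, hP00⟩ := exists_frame_of_levelRaising (Ideal.absNorm w.asIdeal) hq (fracModPrime 𝓡 𝔮 φ) hlr
  haveI := h𝔓.1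
  refine isSteinbergShapedAt_of_prime (fracModPrime 𝓡 𝔮) h𝔓 P (fun σ hσ => ?_) (fun σ hσ => ?_) (fun σ hσ => ?_)
  · exact conj_apply_one_zero_eq_zero_of_mem_decompositionSubgroup 𝓡 𝔮 hunr h𝔓 hφ P hP10 hσ
  · have h1 : fracModPrime 𝓡 𝔮 σ = 1 := by
      change Matrix.GeneralLinearGroup.map _ (𝓡.modPrime 𝔮 σ) = 1
      rw [hunr 𝔓 h𝔓 σ hσ, map_one]
    rw [h1, mul_one, inv_mul_cancel]
    simp
  · have heq : fracModPrime 𝓡 𝔮 σ = fracModPrime 𝓡 𝔮 φ := by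
      have h1 := hunr 𝔓 h𝔓 _ (hσ.mul_inv_mem_inertia hφ)
      rw [map_mul, map_inv, mul_inv_eq_one] at h1
      change Matrix.GeneralLinearGroup.map _ (𝓡.modPrime 𝔮 σ) = Matrix.GeneralLinearGroup.map _ (𝓡.modPrime 𝔮 φ)
      rw [h1]
    rw [heq]
    exact hP00

/-- **(B), `R`-level form: `V(f_w) ∖ V(1 + q) ⊆` Steinberg locus on the unramified-at-`w` primes.**  If
`ρ_𝒟 mod 𝔮` is unramified at `w`, `1 + N w ∉ 𝔮`, and `f_w(φ) = N w · tr(ρ_𝒟(φ))² − (1 + N w)² · det(ρ_𝒟(φ)) ∈ 𝔮`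
for some arithmetic Frobenius `φ` at some `𝔓 ∣ w`, then `𝔮 ∈ steinbergLocus 𝓡 w`. [folklore] -/
theorem mem_steinbergLocus_of_levelRaising_mem (𝓡 : NearlyOrdinaryDeformationRing.{0} 𝒟)
    (w : HeightOneSpectrum (𝓞 F)) (𝔮 : PrimeSpectrum 𝓡.R)
    (hunr : Deformation.IsUnramifiedAt w (𝓡.modPrime 𝔮))
    (hq : (1 + (Ideal.absNorm w.asIdeal : 𝓡.R)) ∉ 𝔮.asIdeal)
    {𝔓 : Ideal (absIntegers (𝓞 F) F)} (h𝔓 : 𝔓 ∈ w.primesAbove)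
    {φ : absoluteGaloisGroup F} (hφ : IsArithFrobAt (𝓞 F) φ 𝔓)
    (hlr : (Ideal.absNorm w.asIdeal : 𝓡.R) * Matrix.trace (𝓡.ρ φ).val ^ 2 -
        (1 + (Ideal.absNorm w.asIdeal : 𝓡.R)) ^ 2 * Matrix.det (𝓡.ρ φ).val ∈ 𝔮.asIdeal) :
    𝔮 ∈ steinbergLocus 𝓡 w := by
  set f : 𝓡.R →+* FractionRing (𝓡.R ⧸ 𝔮.asIdeal) :=
    (algebraMap (𝓡.R ⧸ 𝔮.asIdeal) (FractionRing (𝓡.R ⧸ 𝔮.asIdeal))).comp (Ideal.Quotient.mk 𝔮.asIdeal) with hf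
  have hfinj : ∀ r, f r = 0 → r ∈ 𝔮.asIdeal := fun r hr => by
    rw [hf, RingHom.comp_apply, map_eq_zero_iff _ (IsFractionRing.injective _ _),
      Ideal.Quotient.eq_zero_iff_mem] at hr
    exact hr
  have hval : ∀ i j, (fracModPrime 𝓡 𝔮 φ).val i j = f ((𝓡.ρ φ).val i j) := fun _ _ => rfl
  refine mem_steinbergLocus_of_levelRaising 𝓡 w 𝔮 hunr ?_ h𝔓 hφ ?_
  · intro h0
    refine hq (hfinj _ ?_)
    rw [map_add, map_one, map_natCast, h0]
  · have h0 : f ((Ideal.absNorm w.asIdeal : 𝓡.R) * Matrix.trace (𝓡.ρ φ).val ^ 2 -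
        (1 + (Ideal.absNorm w.asIdeal : 𝓡.R)) ^ 2 * Matrix.det (𝓡.ρ φ).val) = 0 := by
      rw [hf, RingHom.comp_apply, Ideal.Quotient.eq_zero_iff_mem.mpr hlr, map_zero]
    rw [Matrix.trace_fin_two, Matrix.det_fin_two] at h0 ⊢
    simp only [map_sub, map_mul, map_pow, map_add, map_one, map_natCast, ← hval] at h0
    exact sub_eq_zero.mp h0

end Galois

/-! ## 4. The registered wrapper -/

/-- **Registered sub-goal `stub_iharaCrossingLocal_auxLevelRaisingDivisor` of stmt-Langlands-12919** (helper for
the crossing stub `stub_iharaCrossingLocal`): for `ρ_𝒟 mod 𝔮` unramified at `w` and `1 + N w ≠ 0` in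
`Frac(R/𝔮)`, the level-raising identity `N w · tr² = (1 + N w)² · det` for ONE arithmetic Frobenius at ONE prime
above `w` puts `𝔮` in the Steinberg locus at `w`. [folklore] -/
theorem stub_iharaCrossingLocal_auxLevelRaisingDivisor :
    ∀ (F : Type) [Field F] [NumberField F] (p : ℕ) (𝒪 : Type) [CommRing 𝒪] (k : Type) [Field k] [Algebra 𝒪 k] (𝒟 : NearlyOrdinaryDatum F p 𝒪 k) (𝓡 : NearlyOrdinaryDeformationRing.{0} 𝒟) (w : HeightOneSpectrum (𝓞 F)) (𝔮 : PrimeSpectrum 𝓡.R), Deformation.IsUnramifiedAt w (𝓡.modPrime 𝔮) → (1 + (Ideal.absNorm w.asIdeal : FractionRing (𝓡.R ⧸ 𝔮.asIdeal))) ≠ 0 → ∀ 𝔓 ∈ w.primesAbove, ∀ φ : absoluteGaloisGroup F, IsArithFrobAt (𝓞 F) φ 𝔓 → (Ideal.absNorm w.asIdeal : FractionRing (𝓡.R ⧸ 𝔮.asIdeal)) * Matrix.trace (fracModPrime 𝓡 𝔮 φ).val ^ 2 = (1 + (Ideal.absNorm w.asIdeal : FractionRing (𝓡.R ⧸ 𝔮.asIdeal)))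 ^ 2 * Matrix.det (fracModPrime 𝓡 𝔮 φ).val → 𝔮 ∈ steinbergLocus 𝓡 w :=
  fun _ _ _ _ _ _ _ _ _ _ 𝓡 w 𝔮 hunr hq _ h𝔓 _ hφ hlr => mem_steinbergLocus_of_levelRaising 𝓡 w 𝔮 hunr hq h𝔓 hφ hlr

end

end Summit.Langlands.Langlands.Cruxes.ReducibleOrdinaryProModular.SteinbergHyperplane
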